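import Mathlib
import HarnessLib
import Summits.KontsevichZagierPeriods.KontsevichZagierPeriods.Theorems.LinRedNormalFormResidualBeyondGenusZeroDimOneSplit
import Literature.NumberTheory.Transcendental.AperyIrrationality
import Literature.NumberTheory.Transcendental.MultipleZetaValuesBridgeProofs

/-!
# Route LinRedNormalForm, item `ResidualBeyondGenusZero` (stmt-KontsevichZagierPeriods-3917): strength of the transcendence input of line `dim-one-splice`

The registered stub 4 of line `dim-one-splice` (`Cruxes/ResidualBeyondGenusZero/Lines/dim_one_splice.lean`),
the sector's DECLARED transcendence input, reads

  `Cap :≡ ∀ h ∈ H₁, eval h ∈ closure wordValueSet → ∃ q : ℚ, eval h = q`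

— a `ℤ`-combination of one-dimensional representations whose value lies in the subgroup generated by
the values `q·ζ(ε)` of the MZV word representations (the `ℚ`-span of `1` and the multiple zeta
values) has a RATIONAL value. The line file records `Cap → π ∉ closure wordValueSet`. This file lands
a sharper strength certificate:

* `ratCast_of_cap_of_isAlgebraic` — **`Cap` implies that every real ALGEBRAIC number in the MZV value
  subgroup is rational** (`𝒵 ∩ ℚ̄ = ℚ`): an algebraic `a` is the value of the one-dimensional
  representation `[Δ₁, a]` (`oneRep.constMul a`), which lies in `H₁`;
* `transcendental_of_cap` — hence every IRRATIONAL element of the MZV value subgroup is transcendental;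
* `transcendental_zeta_three_of_cap` — in particular **`Cap` implies that `ζ(3)` is transcendental**
  (Apéry: `ζ(3)` is irrational, `Apery.irrational_zeta_three`; `ζ(3) = multipleZeta [3]` is the value
  of Kontsevich's word representation, `multipleZeta_mem_wordValueSet`), an open problem; likewise for
  every multiple zeta value known to be irrational (`transcendental_multipleZeta_of_cap_of_irrational`).

So stub 4 is at least as strong as the transcendence of `ζ(3)`: it is conjecture-grade (declared), not
a prover target, exactly as the line's census says — now with a named open problem below it.

References: R. Apéry, Astérisque 61 (1979) 11–13; M. Kontsevich, D. Zagier, *Periods* (2001), §1.1;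
D. Zagier, *Values of zeta functions and their applications* (1994), §1.
-/

noncomputable section

namespace Summit.KontsevichZagierPeriods.ResidualBeyondGenusZero

open Literature.NumberTheory.Transcendental
open Summit.KontsevichZagierPeriods.SymplecticScissors.RealOnePeriodRelationsNegative (H₁)
open Summit.KontsevichZagierPeriods.DihedralNormalForm.Negative (wordValueSet oneRep oneRep_value)

/-- **Every real algebraic number is the value of an element of `H₁`**: `a = eval [Δ₁, a]`, the
open unit interval with the constant (hence `ℚ`-semialgebraic, `a` being algebraic) integrand `a`.
[Kontsevich–Zagier 2001, §1.1] -/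
theorem exists_mem_H₁_eval_eq_of_isAlgebraic {a : ℝ} (ha : IsAlgebraic ℚ a) :
    ∃ h ∈ H₁, KZ.eval h = a :=
  ⟨KZ.of (oneRep.constMul a ha), AddSubgroup.subset_closure ⟨_, rfl⟩, by
    rw [KZ.eval_of, KZ.IntegralRep.value_constMul, oneRep_value, mul_one]⟩

/-- **`Cap` forces the algebraic elements of the MZV value subgroup to be rational** (`𝒵 ∩ ℚ̄ = ℚ`
in the typing of the line): apply `Cap` to `[Δ₁, a] ∈ H₁`. [folklore] -/
theorem ratCast_of_cap_of_isAlgebraic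
    (hT : ∀ h ∈ H₁, KZ.eval h ∈ AddSubgroup.closure wordValueSet → ∃ q : ℚ, KZ.eval h = q)
    {a : ℝ} (hmem : a ∈ AddSubgroup.closure wordValueSet) (ha : IsAlgebraic ℚ a) :
    ∃ q : ℚ, a = q := by
  obtain ⟨h, hh, hha⟩ := exists_mem_H₁_eval_eq_of_isAlgebraic ha
  obtain ⟨q, hq⟩ := hT h hh (by rw [hha]; exact hmem)
  exact ⟨q, by rw [← hha, hq]⟩

/-- **`Cap` makes every irrational element of the MZV value subgroup transcendental.** [folklore] -/
theorem transcendental_of_cap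
    (hT : ∀ h ∈ H₁, KZ.eval h ∈ AddSubgroup.closure wordValueSet → ∃ q : ℚ, KZ.eval h = q)
    {x : ℝ} (hmem : x ∈ AddSubgroup.closure wordValueSet) (hirr : Irrational x) :
    Transcendental ℚ x := by
  intro hx
  obtain ⟨q, hq⟩ := ratCast_of_cap_of_isAlgebraic hT hmem hx
  exact hirr ⟨q, hq.symm⟩

/-- **Every multiple zeta value lies in the MZV value set**: `ζ(s)` is the value of Kontsevich's
word representation `KZ.mzvRep s` (`[Δ_w, ∏ᵢ ω_{εᵢ}(tᵢ)]`, rational factor `q = 1`;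
`KZ.mzvRep_value_holds`). [Kontsevich–Zagier 2001, §1.1; Zagier 1994, §9] -/
theorem multipleZeta_mem_wordValueSet (s : List ℕ) (hs : MZV.IsAdmissible s) :
    multipleZeta s ∈ wordValueSet := by
  have h₁ := KZ.mzvIntegrand_isSemialgebraicFunOn_holds s
  have h₂ := KZ.mzvIntegrand_integrableOn_holds s hs
  refine ⟨MZV.weight s, fun i => (MZV.binaryWord s).getD i false, 1, KZ.mzvRep s hs h₁ h₂, rfl, ?_,
    (KZ.mzvRep_value_holds s hs h₁ h₂).symm⟩
  intro t _
  show KZ.mzvIntegrand s t = _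
  simp only [KZ.mzvIntegrand, KZ.mzvForm, Rat.cast_one, one_mul]

/-- **`Cap` implies the transcendence of every irrational multiple zeta value.** [folklore] -/
theorem transcendental_multipleZeta_of_cap_of_irrational
    (hT : ∀ h ∈ H₁, KZ.eval h ∈ AddSubgroup.closure wordValueSet → ∃ q : ℚ, KZ.eval h = q)
    (s : List ℕ) (hs : MZV.IsAdmissible s) (hirr : Irrational (multipleZeta s)) :
    Transcendental ℚ (multipleZeta s) :=
  transcendental_of_cap hT (AddSubgroup.subset_closure (multipleZeta_mem_wordValueSet s hs)) hirr

/-- **`ζ(3)` is irrational** in the MZV typing: `multipleZeta [3] = zetaValue 3`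
(`multipleZeta_singleton_eq_zetaValue_of_ne_zero`) and Apéry's theorem
(`Apery.irrational_zeta_three`, proved in the tree). [Apéry 1979] -/
theorem irrational_multipleZeta_three : Irrational (multipleZeta [3]) := by
  rw [multipleZeta_singleton_eq_zetaValue_of_ne_zero (by norm_num : (3 : ℕ) ≠ 0)]
  exact Apery.irrational_zeta_three

/-- **STRENGTH CERTIFICATE FOR STUB 4: `Cap` implies that `ζ(3)` is transcendental** — an open
problem (only irrationality is known, Apéry 1979). Hence the declared transcendence input of line
`dim-one-splice` is conjecture-grade and not a prover target. [folklore] -/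
theorem transcendental_zeta_three_of_cap :
    (∀ h ∈ H₁, KZ.eval h ∈ AddSubgroup.closure wordValueSet → ∃ q : ℚ, KZ.eval h = q) →
      Transcendental ℚ (multipleZeta [3]) :=
  fun hT => transcendental_multipleZeta_of_cap_of_irrational hT [3] (by decide) irrational_multipleZeta_three

/-- The same certificate for Riemann's `zetaValue 3 = ∑ n⁻³`. [folklore] -/
theorem transcendental_zetaValue_three_of_cap
    (hT : ∀ h ∈ H₁, KZ.eval h ∈ AddSubgroup.closure wordValueSet → ∃ q : ℚ, KZ.eval h = q) :
    Transcendental ℚ (zetaValue 3) := by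
  rw [← multipleZeta_singleton_eq_zetaValue_of_ne_zero (by norm_num : (3 : ℕ) ≠ 0)]
  exact transcendental_zeta_three_of_cap hT

end Summit.KontsevichZagierPeriods.ResidualBeyondGenusZero

end
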